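import Literature.NumberTheory.Rogawski1990.KottwitzSignProductFormula
import Literature.NumberTheory.Rogawski1990.AdelicStableOrbitalEulerDischargeG2Semisimple
import HarnessLib

/-!
# Kottwitz signs, VIII: the adelic sign weight is EULER on the matching classes of a split-singular rational element
# (`e_𝐀(c) = e_∞(c_∞) · ∏_{v ∈ S} e_v(c_v)`, `e_v(c_v) = 1` off a finite `S`) (Rogawski 1990, §4.1 (4.1.2) pp. 39–40; Kottwitz 1986, Prop. 7.1, §9)

Topic `NumberTheory/Rogawski1990`; namespace `Literature.NumberTheory.Rogawski1990`.  THEOREMS ONLY (no definition, no named fact, no instance,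
no notation, no `sorry`).  Cell `pub/hodgecm-mathlib`, ENGINE T1 (crux H413 = `stmt-HodgeConjecture-24833`), row O7 «singular semisimple classes»,
«KOTTWITZ SIGNS» (O7 OWNER WORD #24 (R-a) ∕ #26 (1)(e); A-p16 (g21)'s (E-fac′)∕(E-fac) `SignWeightIsEuler(G)`, A-p01 (g16)'s (SA-st-w) binders `hwE′`∕`hwE`);
sequel of ★ `KottwitzSignProductFormula`.  HC_CM is proved only modulo the printed citations until rung 0 closes; this file discharges none of them.

## The mathematics

`kottwitzSignAdelic g := e_∞(g_∞) · ∏ᶠ_v e_v(g_v)` (★ `KottwitzSignCM`) is a genuine FINITE product on the adelic stable class of a rational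
split-singular non-central `γ` — but NOT on an arbitrary adelic class (an adèle can have anisotropic eigenplanes at infinitely many places; the
finiteness is a property of the MATCHING classes).  For a matching adèle `q` over `γ₀ ↔ γ` (★ `MatchingAdeleG₂ L H₁ H₂ γ₀`, `γ ∈ U(H₂)(L⁺)`
rational): at almost every `v`, `q_v ∈ K_v` is `K_v`-conjugate to `γ_v` (Kottwitz's Prop. 7.1 at a semisimple element, ★
`MatchingAdeleG₂.eventuallyKConj_rel_of_isSemisimpleElt` + ★ `MatchingAdeleG₂.eventually_map_toLocal_eq_mk_of_eventuallyKConj`), so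
`e_v(q_v) = e_v(γ_v)` (class function), and `e_v(γ_v) = 1` for almost every `v` (★ `eventually_kottwitzSignLocal_toAdelic_eq_one`, Hilbert
symbols of the diagonal frame).  Hence the support is finite and `kottwitzSignWeight ⟦q⟧ = e_∞ · ∏_{v ∈ S} e_v` for a FINITE `S` off which
`e_v = 1`: **`MatchingAdeleG₂.exists_finset_kottwitzSignWeight_eq`** — A-p16's (E-fac′) text `SignWeightIsEuler` VERBATIM at
`E′ := kottwitzSignWeight L 3 H₂`, `wloc′ v := (↑) ∘ kottwitzSignLocal L 3 H₂ v`, `warch′ := kottwitzSignArchWeight L 3 H₂`, for every pair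
`(H₁, H₂)` (self-carrier `H₂ = H₁`; quasi-split carrier `H₂ = Φ₃` through ★ `MatchingAdeleG.toMatchingAdeleG₂` ∕ ★ `exists_corresponds_antidiagThree_all`).

## References
* [Rogawski1990] J. D. Rogawski, *Automorphic Representations of Unitary Groups in Three Variables*, Ann. of Math. Stud. 123 (1990), §4.1 (4.1.2)
  pp. 39–40; §5.4 p. 72.
* [Kottwitz1986] R. E. Kottwitz, *Stable trace formula: elliptic singular terms*, Math. Ann. 275 (1986), Prop. 7.1, §9.
-/

set_option autoImplicit false

noncomputable section

open NumberField IsDedekindDomain Matrix Filter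
open scoped MatrixGroups

namespace Literature.NumberTheory.Rogawski1990

open Literature.NumberTheory.Automorphic
open Literature.AlgebraicGeometry.ShimuraVarieties (unitaryGroup)

variable {L : Type} [Field L] [NumberField L] [IsCMField L] {H₁ H₂ : Matrix (Fin 3) (Fin 3) L} {γ₀ : (UnitaryGroup.cmDatum L 3 H₁).Rational}

/-- **On a matching class the local signs are `1` almost everywhere**: for `c ∈ 𝒞_𝐀(γ₀)` on `U(H₂)` and a rational correspondent
`γ ∈ U(H₂)(L⁺)` of `γ₀` which is split-singular non-central, `e_v((out c)_v) = 1` for all but finitely many `v` (Kottwitz 7.1 a.e. +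
`e_v(γ_v) = 1` a.e.). [cite: Kottwitz1986, Prop. 7.1] [cite: Rogawski1990, §4.1 (4.1.2) p. 40] -/
theorem MatchingAdeleG₂.eventually_kottwitzSignLocal_out_eq_one (hH₂ : (H₂.map (cmConjRingHom L))ᵀ = H₂) (hdet : H₂.det ≠ 0)
    {γ : (UnitaryGroup.cmDatum L 3 H₂).Rational} (hγ : Corresponds (cmConjRingHom L) H₁ H₂ γ₀ γ) {α β : L} (hαβ : α ≠ β)
    (hγab : ((((γ : unitaryGroup (cmConjRingHom L) H₂).val : GL (Fin 3) L).val : Matrix (Fin 3) (Fin 3) L) - α • 1) *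
      ((((γ : unitaryGroup (cmConjRingHom L) H₂).val : GL (Fin 3) L).val : Matrix (Fin 3) (Fin 3) L) - β • 1) = 0)
    (hα : (((γ : unitaryGroup (cmConjRingHom L) H₂).val : GL (Fin 3) L).val : Matrix (Fin 3) (Fin 3) L) ≠ α • 1)
    (hβ : (((γ : unitaryGroup (cmConjRingHom L) H₂).val : GL (Fin 3) L).val : Matrix (Fin 3) (Fin 3) L) ≠ β • 1)
    {c : ConjClasses (UnitaryGroup.cmDatum L 3 H₂).Adelic} (hc : c ∈ MatchingAdeleG₂.classes L H₁ H₂ γ₀) :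
    ∀ᶠ v : HeightOneSpectrum (𝓞 ↥(maximalRealSubfield L)) in cofinite,
      kottwitzSignLocal L 3 H₂ v (ConjClasses.mk ((UnitaryGroup.cmDatum L 3 H₂).toLocal v (Quotient.out c))) = 1 := by
  have hss : IsSemisimpleElt (cmConjRingHom L) H₂ γ := Literature.LinearAlgebra.Matrix.isSemisimple_toLin'_of_mul_sub_eq_zero hαβ hγab
  have hKrel := MatchingAdeleG₂.eventuallyKConj_rel_of_isSemisimpleElt (L := L) (H₁ := H₁) (H₂ := H₂) (γ₀ := γ₀) hH₂ hdet hγ hss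
  have hev := MatchingAdeleG₂.eventually_map_toLocal_eq_mk_of_eventuallyKConj (L := L) (H₁ := H₁) (H₂ := H₂) (γ₀ := γ₀) hKrel hγ hc
  have hone := eventually_kottwitzSignLocal_toAdelic_eq_one (H := H₂) hH₂ hdet γ hαβ hγab hα hβ
  filter_upwards [hev, hone] with v hv h1
  have hmk : ConjClasses.mk ((UnitaryGroup.cmDatum L 3 H₂).toLocal v (Quotient.out c)) =
      ConjClasses.map ((UnitaryGroup.cmDatum L 3 H₂).toLocal v) c := by
    conv_rhs => rw [← Quotient.out_eq c]
    exact (conjClasses_map_mk _ _).symm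
  rw [hmk, hv]
  exact h1

/-- **(E-fac′)∕(E-fac) — THE ADELIC SIGN WEIGHT IS EULER ON THE MATCHING CLASSES**: for `c ∈ 𝒞_𝐀(γ₀)` on `U(H₂)` (with a rational
split-singular non-central correspondent `γ ∈ U(H₂)(L⁺)` of `γ₀`) there is a FINITE set `S_w` of finite places off which
`e_v((out c)_v) = 1` and `kottwitzSignWeight c = e_∞((out c)_∞) · ∏_{v ∈ S_w} e_v((out c)_v)` (as complex numbers) — A-p16 (g21)'s
`SignWeightIsEuler` ∕ A-p01 (g16)'s `hwE′`∕`hwE` at `E := kottwitzSignWeight L 3 H₂`, `wloc v := (↑) ∘ kottwitzSignLocal L 3 H₂ v`,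
`warch := kottwitzSignArchWeight L 3 H₂`. [cite: Rogawski1990, §4.1 (4.1.2) pp. 39–40; §5.4 p. 72] [cite: Kottwitz1986, Prop. 7.1, §9] -/
theorem MatchingAdeleG₂.exists_finset_kottwitzSignWeight_eq (hH₂ : (H₂.map (cmConjRingHom L))ᵀ = H₂) (hdet : H₂.det ≠ 0)
    {γ : (UnitaryGroup.cmDatum L 3 H₂).Rational} (hγ : Corresponds (cmConjRingHom L) H₁ H₂ γ₀ γ) {α β : L} (hαβ : α ≠ β)
    (hγab : ((((γ : unitaryGroup (cmConjRingHom L) H₂).val : GL (Fin 3) L).val : Matrix (Fin 3) (Fin 3) L) - α • 1) *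
      ((((γ : unitaryGroup (cmConjRingHom L) H₂).val : GL (Fin 3) L).val : Matrix (Fin 3) (Fin 3) L) - β • 1) = 0)
    (hα : (((γ : unitaryGroup (cmConjRingHom L) H₂).val : GL (Fin 3) L).val : Matrix (Fin 3) (Fin 3) L) ≠ α • 1)
    (hβ : (((γ : unitaryGroup (cmConjRingHom L) H₂).val : GL (Fin 3) L).val : Matrix (Fin 3) (Fin 3) L) ≠ β • 1)
    {c : ConjClasses (UnitaryGroup.cmDatum L 3 H₂).Adelic} (hc : c ∈ MatchingAdeleG₂.classes L H₁ H₂ γ₀) :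
    ∃ Sw : Finset (HeightOneSpectrum (𝓞 ↥(maximalRealSubfield L))),
      (∀ v ∉ Sw, ((((kottwitzSignLocal L 3 H₂ v (ConjClasses.mk ((UnitaryGroup.cmDatum L 3 H₂).toLocal v (Quotient.out c))) : ℤˣ) : ℤ) : ℂ)) = 1) ∧
      kottwitzSignWeight L 3 H₂ c =
        kottwitzSignArchWeight L 3 H₂
            (ConjClasses.mk (UnitaryGroup.archPart (↥(maximalRealSubfield L)) L (IsCMField.complexConj L) 3 H₂ (Quotient.out c))) *
          ∏ v ∈ Sw, ((((kottwitzSignLocal L 3 H₂ v (ConjClasses.mk ((UnitaryGroup.cmDatum L 3 H₂).toLocal v (Quotient.out c))) : ℤˣ) : ℤ) : ℂ)) := by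
  classical
  have hev := MatchingAdeleG₂.eventually_kottwitzSignLocal_out_eq_one (H₁ := H₁) (γ₀ := γ₀) hH₂ hdet hγ hαβ hγab hα hβ hc
  set f : HeightOneSpectrum (𝓞 ↥(maximalRealSubfield L)) → ℤˣ :=
    fun v => kottwitzSignLocal L 3 H₂ v (ConjClasses.mk ((UnitaryGroup.cmDatum L 3 H₂).toLocal v (Quotient.out c))) with hf
  have hfin : (Function.mulSupport f).Finite := by
    refine (Filter.eventually_cofinite.1 hev).subset fun v hv => ?_
    exact hv
  refine ⟨hfin.toFinset, fun v hv => ?_, ?_⟩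
  · have hv' : v ∉ Function.mulSupport f := by rwa [Set.Finite.mem_toFinset] at hv
    rw [Function.notMem_mulSupport] at hv'
    rw [show kottwitzSignLocal L 3 H₂ v (ConjClasses.mk ((UnitaryGroup.cmDatum L 3 H₂).toLocal v (Quotient.out c))) = f v from rfl, hv',
      Units.val_one, Int.cast_one]
  · -- `kottwitzSignWeight c = e_𝐀(out c) = e_∞ · ∏ᶠ e_v`, and `∏ᶠ = ∏ over the support`
    have hfp : ∏ᶠ v, f v = ∏ v ∈ hfin.toFinset, f v :=
      finprod_eq_prod_of_mulSupport_subset f (by rw [Set.Finite.coe_toFinset])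
    have hw : kottwitzSignWeight L 3 H₂ c =
        (((kottwitzSignArch L 3 H₂ (ConjClasses.mk (UnitaryGroup.archPart (↥(maximalRealSubfield L)) L (IsCMField.complexConj L) 3 H₂
            (Quotient.out c))) * ∏ᶠ v, f v : ℤˣ) : ℤ) : ℂ) := rfl
    rw [hw, hfp, kottwitzSignArchWeight, Units.val_mul, Int.cast_mul, Units.coe_prod, Int.cast_prod]

/-- **The self-carrier case** (`H₂ = H₁ = H`, `γ = γ₀`): for `c ∈ MatchingAdeleG₂.classes L H H γ₀` with `γ₀` split-singular non-central.
[cite: Rogawski1990, §4.1 (4.1.2) pp. 39–40; §5.4 p. 72] [cite: Kottwitz1986, Prop. 7.1] -/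
theorem MatchingAdeleG₂.exists_finset_kottwitzSignWeight_eq_self {H : Matrix (Fin 3) (Fin 3) L} (hH : (H.map (cmConjRingHom L))ᵀ = H)
    (hdet : H.det ≠ 0) (γ₀ : (UnitaryGroup.cmDatum L 3 H).Rational) {α β : L} (hαβ : α ≠ β)
    (hγab : ((((γ₀ : unitaryGroup (cmConjRingHom L) H).val : GL (Fin 3) L).val : Matrix (Fin 3) (Fin 3) L) - α • 1) *
      ((((γ₀ : unitaryGroup (cmConjRingHom L) H).val : GL (Fin 3) L).val : Matrix (Fin 3) (Fin 3) L) - β • 1) = 0)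
    (hα : (((γ₀ : unitaryGroup (cmConjRingHom L) H).val : GL (Fin 3) L).val : Matrix (Fin 3) (Fin 3) L) ≠ α • 1)
    (hβ : (((γ₀ : unitaryGroup (cmConjRingHom L) H).val : GL (Fin 3) L).val : Matrix (Fin 3) (Fin 3) L) ≠ β • 1)
    {c : ConjClasses (UnitaryGroup.cmDatum L 3 H).Adelic} (hc : c ∈ MatchingAdeleG₂.classes L H H γ₀) :
    ∃ Sw : Finset (HeightOneSpectrum (𝓞 ↥(maximalRealSubfield L))),
      (∀ v ∉ Sw, ((((kottwitzSignLocal L 3 H v (ConjClasses.mk ((UnitaryGroup.cmDatum L 3 H).toLocal v (Quotient.out c))) : ℤˣ) : ℤ) : ℂ)) = 1) ∧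
      kottwitzSignWeight L 3 H c =
        kottwitzSignArchWeight L 3 H
            (ConjClasses.mk (UnitaryGroup.archPart (↥(maximalRealSubfield L)) L (IsCMField.complexConj L) 3 H (Quotient.out c))) *
          ∏ v ∈ Sw, ((((kottwitzSignLocal L 3 H v (ConjClasses.mk ((UnitaryGroup.cmDatum L 3 H).toLocal v (Quotient.out c))) : ℤˣ) : ℤ) : ℂ)) :=
  MatchingAdeleG₂.exists_finset_kottwitzSignWeight_eq hH hdet (IsConj.refl _) hαβ hγab hα hβ hc

/-- **The quasi-split carrier** (`H₂ = Φ₃`, classes ★ `MatchingAdeleG.classes L H γ₀` = ★ `MatchingAdeleG₂.classes L H Φ₃ γ₀` by ★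
`MatchingAdeleG₂.classes_antidiagThree`; the rational split-singular correspondent `γ ∈ U(Φ₃)(L⁺)` exists by ★ `exists_corresponds_antidiagThree_all`
and inherits `(γ − α)(γ − β) = 0` by ★ `mul_sub_smul_mul_sub_smul_eq_zero_of_isConj`) — A-p16 (g21)'s (E-fac) `SignWeightIsEulerG` ∕ A-p01's `hwE`.
[cite: Rogawski1990, §4.1 (4.1.2) pp. 39–40; §5.4 p. 72] [cite: Kottwitz1986, Prop. 7.1] -/
theorem MatchingAdeleG.exists_finset_kottwitzSignWeight_eq {H : Matrix (Fin 3) (Fin 3) L} {γ₁ : (UnitaryGroup.cmDatum L 3 H).Rational}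
    {γ : (UnitaryGroup.cmDatum L 3 (Matrix.of fun i j : Fin 3 => if i.val + j.val + 1 = 3 then (1 : L) else 0)).Rational}
    (hγ : Corresponds (cmConjRingHom L) H _ γ₁ γ) {α β : L} (hαβ : α ≠ β)
    (hγab : ((((γ : unitaryGroup (cmConjRingHom L) (Matrix.of fun i j : Fin 3 => if i.val + j.val + 1 = 3 then (1 : L) else 0)).val :
        GL (Fin 3) L).val : Matrix (Fin 3) (Fin 3) L) - α • 1) *
      ((((γ : unitaryGroup (cmConjRingHom L) (Matrix.of fun i j : Fin 3 => if i.val + j.val + 1 = 3 then (1 : L) else 0)).val :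
        GL (Fin 3) L).val : Matrix (Fin 3) (Fin 3) L) - β • 1) = 0)
    (hα : (((γ : unitaryGroup (cmConjRingHom L) (Matrix.of fun i j : Fin 3 => if i.val + j.val + 1 = 3 then (1 : L) else 0)).val :
        GL (Fin 3) L).val : Matrix (Fin 3) (Fin 3) L) ≠ α • 1)
    (hβ : (((γ : unitaryGroup (cmConjRingHom L) (Matrix.of fun i j : Fin 3 => if i.val + j.val + 1 = 3 then (1 : L) else 0)).val :
        GL (Fin 3) L).val : Matrix (Fin 3) (Fin 3) L) ≠ β • 1)
    {c : ConjClasses (UnitaryGroup.cmDatum L 3 (Matrix.of fun i j : Fin 3 => if i.val + j.val + 1 = 3 then (1 : L) else 0)).Adelic}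
    (hc : c ∈ MatchingAdeleG.classes L H γ₁) :
    ∃ Sw : Finset (HeightOneSpectrum (𝓞 ↥(maximalRealSubfield L))),
      (∀ v ∉ Sw, ((((kottwitzSignLocal L 3 (Matrix.of fun i j : Fin 3 => if i.val + j.val + 1 = 3 then (1 : L) else 0) v
          (ConjClasses.mk ((UnitaryGroup.cmDatum L 3 (Matrix.of fun i j : Fin 3 => if i.val + j.val + 1 = 3 then (1 : L) else 0)).toLocal v
            (Quotient.out c))) : ℤˣ) : ℤ) : ℂ)) = 1) ∧
      kottwitzSignWeight L 3 (Matrix.of fun i j : Fin 3 => if i.val + j.val + 1 = 3 then (1 : L) else 0) c =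
        kottwitzSignArchWeight L 3 (Matrix.of fun i j : Fin 3 => if i.val + j.val + 1 = 3 then (1 : L) else 0)
            (ConjClasses.mk (UnitaryGroup.archPart (↥(maximalRealSubfield L)) L (IsCMField.complexConj L) 3
              (Matrix.of fun i j : Fin 3 => if i.val + j.val + 1 = 3 then (1 : L) else 0) (Quotient.out c))) *
          ∏ v ∈ Sw, ((((kottwitzSignLocal L 3 (Matrix.of fun i j : Fin 3 => if i.val + j.val + 1 = 3 then (1 : L) else 0) v
            (ConjClasses.mk ((UnitaryGroup.cmDatum L 3 (Matrix.of fun i j : Fin 3 => if i.val + j.val + 1 = 3 then (1 : L) else 0)).toLocal v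
              (Quotient.out c))) : ℤˣ) : ℤ) : ℂ)) := by
  have hH₂ : ((Matrix.of fun i j : Fin 3 => if i.val + j.val + 1 = 3 then (1 : L) else 0).map (cmConjRingHom L))ᵀ =
      (Matrix.of fun i j : Fin 3 => if i.val + j.val + 1 = 3 then (1 : L) else 0) := by
    ext i j
    fin_cases i <;> fin_cases j <;> simp [Matrix.transpose_apply, Matrix.map_apply]
  have hdet : (Matrix.of fun i j : Fin 3 => if i.val + j.val + 1 = 3 then (1 : L) else 0).det ≠ 0 := by
    rw [Matrix.det_fin_three]
    simp
  rw [← MatchingAdeleG₂.classes_antidiagThree] at hc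
  exact MatchingAdeleG₂.exists_finset_kottwitzSignWeight_eq hH₂ hdet hγ hαβ hγab hα hβ hc

end Literature.NumberTheory.Rogawski1990

end
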